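import Summits.Parity.GeneralizedHardyLittlewood.Theorems.LeeYangFibresAbsoluteUpgradeUniformDefs
import Summits.Parity.GeneralizedHardyLittlewood.Theorems.LeeYangFibresRelativeDimOneLocalAverage
import Literature.NumberTheory.Sieve.LinearEquationsInPrimesProofs
import HarnessLib

/-!
# Route `LeeYangFibres`, crux `AbsoluteUpgrade` (stmt-Parity-14116), line `Sketch` (uniform amplification):
# A = `LocalRatioFacts` — local factors of one-dimensional systems and of their translate-constellations

We prove the registered stub `stub_localRatioFacts : LocalRatioFacts` (vocabulary
`Theorems/LeeYangFibresAbsoluteUpgradeUniformDefs.lean`): the five elementary local facts consumed by the glue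
`UniformSingularMeanGlue` of the line.

1. The exact `d = 1` formula `β_p(Φ) = (p/(p−1))^T (1 − ν_p(Φ)/p)` at every prime `p`
   (`localFactor_eq_rootClassCount`): the integrand of `β_p` is `(p/(p−1))^T` off the root classes and `0` on
   them (`prod_localVonMangoldt_eq_ite`).
2. The union bound `ν_p(Ψ^{(H)}) ≤ (m+1) ν_p(Ψ)` (`card_translatedRoots_le`): modulo `p` the root set of `Ψ^{(H)}`
   is the union of the `m+1` translates `R − H'_j` of the root set `R` of `Ψ`.
3. Bonferroni `(m+1) ν_p(Ψ) ≤ ν_p(Ψ^{(H)}) + collisionCount Ψ H p` (`mul_card_roots_le`): the incidence set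
   `{(x, j) : x ∈ R − H'_j}` has `(m+1) #R` elements; choosing for every root `x` of `Ψ^{(H)}` one translate
   `j₀(x)` containing it, the incidences `(x, j₀(x))` inject into the root set of `Ψ^{(H)}` and the other ones
   into the ordered collision indices `((j₀(x), j), (i, i'))` with `p ∣ Δ_{j₀(x),j,i,i'}(H)`: a common root of
   `ψ_i(· + H'_j)` and `ψ_{i'}(· + H'_{j'})` modulo `p ∤ a_i a_{i'}` forces `p ∣ Δ_{j,j',i,i'}(H)`, and the root is
   determined by `(j', i')`.
4. `1 ≤ ν_p(Ψ) ≤ t` for `p ∤ a_i` and `t ≥ 1` (`card_roots_pos_le`): the form `ψ_i` has exactly the root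
   `−b_i/a_i` modulo `p`.
5. The generic ratio `r = (P − kV) P^m/(P − V)^k`, `k = m+1`, `2kV ≤ P`: `0 < r ≤ 1` and `1 − r ≤ (kV/P)²`
   (`genericRatio_bounds`), from the homogeneous Bernoulli inequalities `P^m (P − kV) ≤ (P − V)^k`
   (`pow_mul_sub_le_pow_sub`) and `P (P − V)^k ≤ P^m (P² − kPV + (mk/2) V²)` (`mul_pow_sub_le`) for `0 ≤ V ≤ P`.

All root counting is transported to the field `ZMod p` (`rootClassCount_eq_card`), where the reduced forms are
the affine maps `x ↦ a_i x + b_i`; the counting facts (2)–(4) are proved for any finite field `F` (section `Roots`).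
References: B. Green, T. Tao, Ann. of Math. 171 (2010), Lemma 1.3 and (1.6) [GreenTao2010]; P. X. Gallagher,
Mathematika 23 (1976), §2 [Gallagher1976].
-/

noncomputable section

open scoped BigOperators Classical Topology
open Finset Filter MeasureTheory Literature.NumberTheory.Sieve
open Summit.Parity.GeneralizedHardyLittlewood.Cruxes.RelativeDimOne.TranslateAmplification

namespace Summit.Parity.GeneralizedHardyLittlewood.Cruxes.AbsoluteUpgrade.UniformAmplification

/-! ### Conjunct (1): the exact `d = 1` formula for `β_p` -/

/-- For a prime `p` the integrand `∏_i Λ_p(φ_i(n))` of `β_p` is `0` if `p ∣ φ_i(n)` for some `i` and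
`(p/(p−1))^T` otherwise. [cite: GreenTao2010, proof of Lemma 1.3] -/
theorem prod_localVonMangoldt_eq_ite {T : ℕ} (Φ : Fin T → AffLinForm 1) {p : ℕ} (hp : p.Prime)
    (n : Fin 1 → ℤ) :
    ∏ i, localVonMangoldt p ((Φ i).eval n) =
      if ∃ i, (p : ℤ) ∣ (Φ i).eval n then 0 else ((p : ℝ) / ((p : ℝ) - 1)) ^ T := by
  rw [prod_localVonMangoldt_prime hp]
  have key : ∀ i, (Φ i).modEval p (fun j => ((n j : ℤ) : ZMod p)) ≠ 0 ↔ ¬ (p : ℤ) ∣ (Φ i).eval n := by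
    intro i
    rw [← AffLinForm.intCast_eval, Ne, ZMod.intCast_zmod_eq_zero_iff_dvd]
  simp_rw [key]
  by_cases h : ∃ i, (p : ℤ) ∣ (Φ i).eval n
  · rw [if_pos h, if_neg (fun hall => by obtain ⟨i, hi⟩ := h; exact hall i hi)]
  · rw [if_neg h, if_pos (fun i hi => h ⟨i, hi⟩)]

/-- The representatives in `rootClassCount` are `{0, …, p−1} ⊆ ℤ` (the definition coerces `Finset.range p`
into `Finset ℤ` through the `Finset` monad); here is the same count over `c ∈ Finset.range p`. [folklore] -/
theorem rootClassCount_eq_card_range {T : ℕ} (Φ : Fin T → AffLinForm 1) (p : ℕ) :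
    rootClassCount Φ p = #{c ∈ Finset.range p | ∃ i, (p : ℤ) ∣ (Φ i).eval fun _ => ((c : ℕ) : ℤ)} := by
  unfold rootClassCount
  have e : ((Finset.range p : Finset ℕ) : Finset ℤ) = (Finset.range p).image fun a : ℕ => (a : ℤ) := by
    ext c
    simp
  rw [e, Finset.filter_image, Finset.card_image_of_injective _ Nat.cast_injective]

/-- **Conjunct (1).** The exact `d = 1` formula at a prime `p`: `β_p(Φ) = (p/(p−1))^T (1 − ν_p(Φ)/p)`, where
`ν_p(Φ) = rootClassCount Φ p` is the number of residues at which some form vanishes modulo `p` (no hypothesis on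
the coefficients). [cite: GreenTao2010, (1.6)] -/
theorem localFactor_eq_rootClassCount {T : ℕ} (Φ : Fin T → AffLinForm 1) {p : ℕ} (hp : p.Prime) :
    localFactor Φ p = ((p : ℝ) / ((p : ℝ) - 1)) ^ T * (1 - (rootClassCount Φ p : ℝ) / p) := by
  rw [localFactor_fin_one,
    Finset.sum_congr rfl fun (c : ℕ) _ => prod_localVonMangoldt_eq_ite Φ hp fun _ => (c : ℤ),
    Finset.sum_ite, Finset.sum_const_zero, zero_add, Finset.sum_const, nsmul_eq_mul]
  have hp0 : (p : ℝ) ≠ 0 := by exact_mod_cast hp.ne_zero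
  have hcard : ((#{c ∈ range p | ¬ ∃ i, (p : ℤ) ∣ (Φ i).eval fun _ => ((c : ℕ) : ℤ)} : ℕ) : ℝ) =
      (p : ℝ) - rootClassCount Φ p := by
    rw [eq_sub_iff_add_eq', rootClassCount_eq_card_range, ← Nat.cast_add,
      Finset.card_filter_add_card_filter_not, card_range]
  rw [hcard]
  generalize ((p : ℝ) / ((p : ℝ) - 1)) ^ T = K
  field_simp

/-! ### Root sets of affine maps of a finite field -/

section Roots

variable {F : Type*} [Field F] [Fintype F] [DecidableEq F]

/-- UNION BOUND for translated root sets: with `R = {x : ∃ i, a_i x + b_i = 0}`, the set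
`{x : ∃ j i, a_i (x + h_j) + b_i = 0} = ⋃_j (R − h_j)` has at most `(m+1) #R` elements. [folklore] -/
theorem card_translatedRoots_le {t m : ℕ} (a b : Fin t → F) (h : Fin (m + 1) → F) :
    #{x : F | ∃ j i, a i * (x + h j) + b i = 0} ≤ (m + 1) * #{x : F | ∃ i, a i * x + b i = 0} := by
  set R : Finset F := {x : F | ∃ i, a i * x + b i = 0} with hR
  have hA : ({x : F | ∃ j i, a i * (x + h j) + b i = 0} : Finset F) =
      Finset.univ.biUnion fun j => R.image fun y => y - h j := by
    ext x
    simp only [hR, Finset.mem_filter, Finset.mem_univ, true_and, Finset.mem_biUnion, Finset.mem_image]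
    constructor
    · rintro ⟨j, i, hx⟩
      exact ⟨j, x + h j, ⟨i, hx⟩, add_sub_cancel_right x (h j)⟩
    · rintro ⟨j, y, ⟨i, hy⟩, rfl⟩
      exact ⟨j, i, by rwa [sub_add_cancel]⟩
  rw [hA]
  calc #(Finset.univ.biUnion fun j => R.image fun y => y - h j)
      ≤ ∑ j, #(R.image fun y => y - h j) := Finset.card_biUnion_le
    _ = ∑ _j : Fin (m + 1), #R :=
        Finset.sum_congr rfl fun j _ => Finset.card_image_of_injective _ sub_left_injective
    _ = (m + 1) * #R := by
        rw [Finset.sum_const, Finset.card_univ, Fintype.card_fin, smul_eq_mul]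

/-- ONE ROOT PER FORM: if all `a_i ≠ 0` and `t ≥ 1` then `1 ≤ #{x : ∃ i, a_i x + b_i = 0} ≤ t` (the root set is
the non-empty image of `i ↦ −b_i/a_i`). [folklore] -/
theorem card_roots_pos_le {t : ℕ} (a b : Fin t → F) (ha : ∀ i, a i ≠ 0) (ht : 1 ≤ t) :
    1 ≤ #{x : F | ∃ i, a i * x + b i = 0} ∧ #{x : F | ∃ i, a i * x + b i = 0} ≤ t := by
  constructor
  · refine Finset.one_le_card.mpr ⟨-b ⟨0, ht⟩ / a ⟨0, ht⟩, ?_⟩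
    rw [Finset.mem_filter]
    refine ⟨Finset.mem_univ _, ⟨0, ht⟩, ?_⟩
    rw [mul_div_cancel₀ _ (ha ⟨0, ht⟩), neg_add_cancel]
  · calc #{x : F | ∃ i, a i * x + b i = 0}
        ≤ #(Finset.univ.image fun i : Fin t => -b i / a i) := by
          refine Finset.card_le_card fun x hx => ?_
          rw [Finset.mem_filter] at hx
          obtain ⟨-, i, hi⟩ := hx
          rw [Finset.mem_image]
          refine ⟨i, Finset.mem_univ _, ?_⟩
          rw [div_eq_iff (ha i)]
          linear_combination -hi
      _ ≤ #(Finset.univ : Finset (Fin t)) := Finset.card_image_le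
      _ = t := by rw [Finset.card_univ, Fintype.card_fin]

/-- BONFERRONI FOR TRANSLATED ROOT SETS. Let `a_i ≠ 0`, `R = {x : ∃ i, a_i x + b_i = 0}`,
`A = {x : ∃ j i, a_i (x + h_j) + b_i = 0} = ⋃_j (R − h_j)`, and let `C` be any set of ordered indices
`((j, j'), (i, i'))` containing all those with `j ≠ j'` for which `ψ_i(· + h_j)` and `ψ_{i'}(· + h_{j'})` have a
common root. Then `(m+1) #R ≤ #A + #C`: the incidence set `S = {(x, j) : x ∈ R − h_j}` has `(m+1) #R`
elements; with a chosen translate `j₀(x) ∋ x` for every `x ∈ A` and chosen form indices, the incidences with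
`j = j₀(x)` inject into `A` by `(x, j) ↦ x`, and the others into `C` by `(x, j) ↦ ((j₀(x), j), (i, i'))`, which is
injective because `x` is the unique root of `ψ_{i'}(· + h_j)`. [folklore] -/
theorem mul_card_roots_le {t m : ℕ} (a b : Fin t → F) (h : Fin (m + 1) → F) (ha : ∀ i, a i ≠ 0)
    (C : (Fin (m + 1) × Fin (m + 1)) × (Fin t × Fin t) → Prop) [DecidablePred C]
    (hC : ∀ x j j' i i', j ≠ j' → a i * (x + h j) + b i = 0 → a i' * (x + h j') + b i' = 0 →
      C ((j, j'), (i, i'))) :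
    (m + 1) * #{x : F | ∃ i, a i * x + b i = 0} ≤
      #{x : F | ∃ j i, a i * (x + h j) + b i = 0} + #{q | C q} := by
  cases t with
  | zero => simp
  | succ t =>
    set R : Finset F := {x : F | ∃ i, a i * x + b i = 0} with hR
    set A : Finset F := {x : F | ∃ j i, a i * (x + h j) + b i = 0} with hA
    -- the incidence set
    set S : Finset (F × Fin (m + 1)) := {s | ∃ i, a i * (s.1 + h s.2) + b i = 0} with hS
    have memR : ∀ x, x ∈ R ↔ ∃ i, a i * x + b i = 0 := fun x => by simp [hR]
    have memA : ∀ x, x ∈ A ↔ ∃ j i, a i * (x + h j) + b i = 0 := fun x => by simp [hA]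
    have memS : ∀ s, s ∈ S ↔ ∃ i, a i * (s.1 + h s.2) + b i = 0 := fun s => by simp [hS]
    -- `#S = (m+1) #R` through `(x, j) ↦ (x + h_j, j)`
    have hScard : #S = (m + 1) * #R := by
      have e : #S = #(R ×ˢ (Finset.univ : Finset (Fin (m + 1)))) := by
        refine Finset.card_nbij' (fun s => (s.1 + h s.2, s.2)) (fun s => (s.1 - h s.2, s.2)) ?_ ?_ ?_ ?_
        · intro s hs
          rw [Finset.mem_coe, memS] at hs
          rw [Finset.mem_coe, Finset.mem_product, memR]
          exact ⟨hs, Finset.mem_univ _⟩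
        · intro s hs
          rw [Finset.mem_coe, Finset.mem_product, memR] at hs
          rw [Finset.mem_coe, memS]
          simpa only [sub_add_cancel] using hs.1
        · exact fun s _ => by simp
        · exact fun s _ => by simp
      rw [e, Finset.card_product, Finset.card_univ, Fintype.card_fin, mul_comm]
    -- a chosen translate through every root of the constellation, a chosen form for every incidence
    have exj : ∀ x ∈ A, ∃ j, ∃ i, a i * (x + h j) + b i = 0 := fun x hx => (memA x).mp hx
    choose! j₀ hj₀ using exj
    have exi : ∀ s ∈ S, ∃ i, a i * (s.1 + h s.2) + b i = 0 := fun s hs => (memS s).mp hs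
    choose! ι hι using exi
    have hxA : ∀ s ∈ S, s.1 ∈ A := fun s hs => (memA s.1).mpr ⟨s.2, (memS s).mp hs⟩
    -- the incidences `(x, j₀ x)` inject into `A`
    have h1 : #(S.filter fun s => s.2 = j₀ s.1) ≤ #A := by
      refine Finset.card_le_card_of_injOn Prod.fst ?_ ?_
      · intro s hs
        rw [Finset.mem_coe, Finset.mem_filter] at hs
        exact hxA s hs.1
      · intro s hs s' hs' heq
        rw [Finset.mem_coe, Finset.mem_filter] at hs hs'
        refine Prod.ext heq ?_
        rw [hs.2, hs'.2]
        exact congrArg j₀ heq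
    -- the other incidences inject into the collision indices
    have h2 : #(S.filter fun s => ¬ s.2 = j₀ s.1) ≤ #{q | C q} := by
      refine Finset.card_le_card_of_injOn (fun s => ((j₀ s.1, s.2), (ι (s.1, j₀ s.1), ι s))) ?_ ?_
      · intro s hs
        rw [Finset.mem_coe, Finset.mem_filter] at hs
        obtain ⟨hsS, hne⟩ := hs
        have h0S : (s.1, j₀ s.1) ∈ S := (memS _).mpr (hj₀ s.1 (hxA s hsS))
        rw [Finset.mem_coe, Finset.mem_filter]
        exact ⟨Finset.mem_univ _, hC s.1 (j₀ s.1) s.2 _ _ (fun e => hne e.symm) (hι _ h0S) (hι s hsS)⟩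
      · intro s hs s' hs' heq
        rw [Finset.mem_coe, Finset.mem_filter] at hs hs'
        simp only [Prod.mk.injEq] at heq
        obtain ⟨⟨-, hj⟩, -, hi⟩ := heq
        have e1 := hι s hs.1
        have e2 := hι s' hs'.1
        rw [hi, hj] at e1
        have e3 : a (ι s') * (s.1 - s'.1) = 0 := by linear_combination e1 - e2
        have hx : s.1 = s'.1 := by
          rcases mul_eq_zero.mp e3 with h4 | h4
          · exact absurd h4 (ha _)
          · exact sub_eq_zero.mp h4
        exact Prod.ext hx hj
    calc (m + 1) * #R = #S := hScard.symm
      _ = #(S.filter fun s => s.2 = j₀ s.1) + #(S.filter fun s => ¬ s.2 = j₀ s.1) :=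
          (Finset.card_filter_add_card_filter_not _).symm
      _ ≤ #A + #{q | C q} := add_le_add h1 h2

end Roots

/-! ### Root classes modulo `p` of one-dimensional systems and of their translate-constellations -/

/-- Divisibility of a value `ψ(n) = a n + b` by `p` is the vanishing of the reduced affine map on `ZMod p`.
[folklore] -/
theorem dvd_eval_iff (ψ : AffLinForm 1) (p : ℕ) (n : ℤ) :
    (p : ℤ) ∣ ψ.eval (fun _ => n) ↔ (ψ.coeff 0 : ZMod p) * (n : ZMod p) + (ψ.const : ZMod p) = 0 := by
  rw [← ZMod.intCast_zmod_eq_zero_iff_dvd]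
  simp only [AffLinForm.eval, Fin.sum_univ_one, Int.cast_add, Int.cast_mul]

/-- `ν_p(Φ)` counted in `ZMod p`: the residues `c < p` with `p ∣ φ_i(c)` for some `i` are in bijection with the
`x : ZMod p` such that `a_i x + b_i = 0` for some `i`. [cite: GreenTao2010, (1.6)] -/
theorem rootClassCount_eq_card {T : ℕ} (Φ : Fin T → AffLinForm 1) (p : ℕ) [NeZero p] :
    rootClassCount Φ p =
      #{x : ZMod p | ∃ i, ((Φ i).coeff 0 : ZMod p) * x + ((Φ i).const : ZMod p) = 0} := by
  rw [rootClassCount_eq_card_range]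
  refine Finset.card_nbij' (fun c : ℕ => (c : ZMod p)) (fun x : ZMod p => x.val) ?_ ?_ ?_ ?_
  · intro c hc
    rw [Finset.mem_coe, Finset.mem_filter] at hc
    obtain ⟨-, i, hi⟩ := hc
    rw [Finset.mem_coe, Finset.mem_filter]
    refine ⟨Finset.mem_univ _, i, ?_⟩
    rw [dvd_eval_iff, Int.cast_natCast] at hi
    exact hi
  · intro x hx
    rw [Finset.mem_coe, Finset.mem_filter] at hx
    obtain ⟨-, i, hi⟩ := hx
    rw [Finset.mem_coe, Finset.mem_filter, Finset.mem_range]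
    refine ⟨ZMod.val_lt x, i, ?_⟩
    rw [dvd_eval_iff, Int.cast_natCast, ZMod.natCast_zmod_val]
    exact hi
  · intro c hc
    rw [Finset.mem_coe, Finset.mem_filter, Finset.mem_range] at hc
    exact ZMod.val_cast_of_lt hc.1
  · intro x _
    exact ZMod.natCast_zmod_val x

/-- The root classes of the translate-constellation counted in `ZMod p`: `x` is a root of the form `(j, i)` of
`Ψ^{(H)}`, namely `ψ_i(· + H'_j)`, iff `a_i (x + H'_j) + b_i = 0`. [folklore] -/
theorem rootClassCount_translateFamily_eq {t m : ℕ} (Ψ : Fin t → AffLinForm 1) (H : Fin m → ℤ) (p : ℕ)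
    [NeZero p] :
    rootClassCount (translateFamily Ψ H) p =
      #{x : ZMod p | ∃ j : Fin (m + 1), ∃ i : Fin t,
        ((Ψ i).coeff 0 : ZMod p) * (x + ((shiftVec H j : ℤ) : ZMod p)) + ((Ψ i).const : ZMod p) = 0} := by
  rw [rootClassCount_eq_card]
  congr 1
  ext x
  simp only [Finset.mem_filter, Finset.mem_univ, true_and]
  constructor
  · rintro ⟨k, hk⟩
    obtain ⟨⟨j, i⟩, rfl⟩ := finProdFinEquiv.surjective k
    refine ⟨j, i, ?_⟩
    rw [translateFamily_apply] at hk
    simp only [translateForm, Int.cast_add, Int.cast_mul] at hk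
    linear_combination hk
  · rintro ⟨j, i, hk⟩
    refine ⟨finProdFinEquiv (j, i), ?_⟩
    rw [translateFamily_apply]
    simp only [translateForm, Int.cast_add, Int.cast_mul]
    linear_combination hk

/-! ### Conjunct (5): the generic ratio -/

/-- Homogeneous first-order Bernoulli inequality: `P^m (P − (m+1) V) ≤ (P − V)^{m+1}` for `0 ≤ V ≤ P`.
[folklore] -/
theorem pow_mul_sub_le_pow_sub {P V : ℝ} (hV : 0 ≤ V) (hVP : V ≤ P) (m : ℕ) :
    P ^ m * (P - (m + 1) * V) ≤ (P - V) ^ (m + 1) := by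
  induction m with
  | zero => simp
  | succ m ih =>
    have hPV : 0 ≤ P - V := sub_nonneg.mpr hVP
    have hP : 0 ≤ P := hV.trans hVP
    have h2 := mul_le_mul_of_nonneg_right ih hPV
    have h3 : 0 ≤ ((m : ℝ) + 1) * (P ^ m * V ^ 2) := by positivity
    push_cast
    rw [pow_succ P m, pow_succ (P - V) (m + 1)]
    nlinarith [h2, h3]

/-- Homogeneous second-order Bernoulli inequality:
`P (P − V)^{m+1} ≤ P^m (P² − (m+1) P V + (m(m+1)/2) V²)` for `0 ≤ V ≤ P`. [folklore] -/
theorem mul_pow_sub_le {P V : ℝ} (hV : 0 ≤ V) (hVP : V ≤ P) (m : ℕ) :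
    P * (P - V) ^ (m + 1) ≤ P ^ m * (P ^ 2 - (m + 1) * P * V + (m : ℝ) * (m + 1) / 2 * V ^ 2) := by
  induction m with
  | zero =>
    simp only [zero_add, pow_one, pow_zero, one_mul, Nat.cast_zero, zero_mul, zero_div, add_zero]
    nlinarith [hV]
  | succ m ih =>
    have hPV : 0 ≤ P - V := sub_nonneg.mpr hVP
    have hP : 0 ≤ P := hV.trans hVP
    have h2 := mul_le_mul_of_nonneg_right ih hPV
    have h3 : 0 ≤ (m : ℝ) * ((m : ℝ) + 1) / 2 * (P ^ m * V ^ 3) := by positivity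
    push_cast
    rw [pow_succ P m, pow_succ (P - V) (m + 1)]
    nlinarith [h2, h3]

/-- **Conjunct (5).** The generic ratio `r = genericRatio m ν p = (p − (m+1)ν) p^m/(p − ν)^{m+1}` satisfies
`0 < r ≤ 1` and `1 − r ≤ ((m+1)ν)²/p²` whenever `0 < p` and `2(m+1)ν ≤ p`. [folklore] -/
theorem genericRatio_bounds (m ν p : ℕ) (hp : 0 < p) (h2 : 2 * ((m + 1) * ν) ≤ p) :
    0 < genericRatio m ν p ∧ genericRatio m ν p ≤ 1 ∧
      1 - genericRatio m ν p ≤ (((m + 1) * ν : ℕ) : ℝ) ^ 2 / (p : ℝ) ^ 2 := by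
  unfold genericRatio
  push_cast
  have hP : (0 : ℝ) < p := by exact_mod_cast hp
  have h2' : 2 * (((m : ℝ) + 1) * ν) ≤ p := by exact_mod_cast h2
  have hV : (0 : ℝ) ≤ ν := Nat.cast_nonneg ν
  have hm : (0 : ℝ) ≤ m := Nat.cast_nonneg m
  have hVp : (ν : ℝ) < p := by nlinarith [mul_nonneg hm hV]
  have hB1 := pow_mul_sub_le_pow_sub hV hVp.le m
  have hB2 := mul_pow_sub_le hV hVp.le m
  have hD : (0 : ℝ) < ((p : ℝ) - ν) ^ (m + 1) := pow_pos (by linarith) _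
  have hPm : (0 : ℝ) < (p : ℝ) ^ m := pow_pos hP m
  have hnum : (0 : ℝ) < ((p : ℝ) - ((m : ℝ) + 1) * ν) * (p : ℝ) ^ m := mul_pos (by linarith) hPm
  refine ⟨div_pos hnum hD, (div_le_one hD).mpr (by linarith), ?_⟩
  rw [one_sub_div hD.ne', div_le_div_iff₀ hD (pow_pos hP 2)]
  have h4 : (0 : ℝ) ≤ ((m : ℝ) + 1) * ((p : ℝ) ^ m * p * (ν : ℝ) ^ 2) := by positivity
  have step1 : (((p : ℝ) - ν) ^ (m + 1) - ((p : ℝ) - ((m : ℝ) + 1) * ν) * (p : ℝ) ^ m) * (p : ℝ) ^ 2 ≤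
      (p : ℝ) * ((m : ℝ) * ((m : ℝ) + 1) / 2 * ((p : ℝ) ^ m * (ν : ℝ) ^ 2)) := by
    have h5 := mul_le_mul_of_nonneg_left hB2 hP.le
    nlinarith [h5]
  have step2 : (p : ℝ) ^ m * p / 2 ≤ ((p : ℝ) - ν) ^ (m + 1) := by
    have h5 : (p : ℝ) ^ m * ((p : ℝ) / 2) ≤ (p : ℝ) ^ m * ((p : ℝ) - ((m : ℝ) + 1) * ν) :=
      mul_le_mul_of_nonneg_left (by linarith) hPm.le
    linarith [hB1, h5]
  calc (((p : ℝ) - ν) ^ (m + 1) - ((p : ℝ) - ((m : ℝ) + 1) * ν) * (p : ℝ) ^ m) * (p : ℝ) ^ 2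
      ≤ (p : ℝ) * ((m : ℝ) * ((m : ℝ) + 1) / 2 * ((p : ℝ) ^ m * (ν : ℝ) ^ 2)) := step1
    _ ≤ (((m : ℝ) + 1) * ν) ^ 2 * ((p : ℝ) ^ m * p / 2) := by nlinarith [h4]
    _ ≤ (((m : ℝ) + 1) * ν) ^ 2 * ((p : ℝ) - ν) ^ (m + 1) :=
        mul_le_mul_of_nonneg_left step2 (sq_nonneg _)

/-! ### The stub -/

/-- **A = `LocalRatioFacts` holds** (registered stub `stub_localRatioFacts` of the line `Sketch`): (1) the exact
`d = 1` formula `β_p(Φ) = (p/(p−1))^T (1 − ν_p(Φ)/p)`; (2) `ν_p(Ψ^{(H)}) ≤ (m+1) ν_p(Ψ)`; (3) Bonferroni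
`(m+1) ν_p(Ψ) ≤ ν_p(Ψ^{(H)}) + collisionCount Ψ H p`; (4) `1 ≤ ν_p(Ψ) ≤ t`; (5) `0 < r_p ≤ 1`,
`1 − r_p ≤ ((m+1)ν/p)²` for the generic ratio. [cite: GreenTao2010, Lemma 1.3] -/
theorem stub_localRatioFacts : LocalRatioFacts := by
  unfold LocalRatioFacts
  refine ⟨fun T p Φ hp => localFactor_eq_rootClassCount Φ hp, ?_, ?_, ?_,
    fun m ν p hp h2 => genericRatio_bounds m ν p hp h2⟩
  · -- (2) union bound
    intro t m p Ψ H hp _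
    haveI := Fact.mk hp
    rw [rootClassCount_translateFamily_eq, rootClassCount_eq_card]
    exact card_translatedRoots_le (fun i => ((Ψ i).coeff 0 : ZMod p)) (fun i => ((Ψ i).const : ZMod p))
      (fun j => ((shiftVec H j : ℤ) : ZMod p))
  · -- (3) Bonferroni
    intro t m p Ψ H hp ha
    haveI := Fact.mk hp
    have ha' : ∀ i, ((Ψ i).coeff 0 : ZMod p) ≠ 0 := fun i h0 =>
      ha i ((ZMod.intCast_zmod_eq_zero_iff_dvd _ _).mp h0)
    have hC : ∀ (x : ZMod p) (j j' : Fin (m + 1)) (i i' : Fin t), j ≠ j' →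
        ((Ψ i).coeff 0 : ZMod p) * (x + ((shiftVec H j : ℤ) : ZMod p)) + ((Ψ i).const : ZMod p) = 0 →
        ((Ψ i').coeff 0 : ZMod p) * (x + ((shiftVec H j' : ℤ) : ZMod p)) + ((Ψ i').const : ZMod p) = 0 →
          j ≠ j' ∧ (p : ℤ) ∣ collisionForm Ψ H j j' i i' := by
      intro x j j' i i' hjj' e1 e2
      refine ⟨hjj', ?_⟩
      rw [← ZMod.intCast_zmod_eq_zero_iff_dvd]
      unfold collisionForm
      push_cast
      linear_combination ((Ψ i').coeff 0 : ZMod p) * e1 - ((Ψ i).coeff 0 : ZMod p) * e2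
    have key := mul_card_roots_le (fun i => ((Ψ i).coeff 0 : ZMod p)) (fun i => ((Ψ i).const : ZMod p))
      (fun j => ((shiftVec H j : ℤ) : ZMod p)) ha'
      (fun q : (Fin (m + 1) × Fin (m + 1)) × (Fin t × Fin t) =>
        q.1.1 ≠ q.1.2 ∧ (p : ℤ) ∣ collisionForm Ψ H q.1.1 q.1.2 q.2.1 q.2.2) hC
    rw [rootClassCount_translateFamily_eq, rootClassCount_eq_card]
    exact key
  · -- (4) one root per form
    intro t p Ψ hp ha ht
    haveI := Fact.mk hp
    have ha' : ∀ i, ((Ψ i).coeff 0 : ZMod p) ≠ 0 := fun i h0 =>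
      ha i ((ZMod.intCast_zmod_eq_zero_iff_dvd _ _).mp h0)
    rw [rootClassCount_eq_card]
    exact card_roots_pos_le (fun i => ((Ψ i).coeff 0 : ZMod p)) (fun i => ((Ψ i).const : ZMod p)) ha' ht

end Summit.Parity.GeneralizedHardyLittlewood.Cruxes.AbsoluteUpgrade.UniformAmplification

end
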